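import Literature.Analysis.FluidPDE.IntermittentJetBounds
import Literature.Analysis.FluidPDE.JetAmplitudes
import Literature.Analysis.FluidPDE.NSRPerturbationVisc
import Literature.Analysis.FluidPDE.OscillatoryExpansion
import Literature.Analysis.FunctionSpaces.TorusInverseLaplacianCalculus
import HarnessLib

/-!
# The intermittent-jet perturbation `w = w^{(p)} + w^{(c)} + w^{(t)}` on `𝕋³`

Analysis/FluidPDE support file (all results proved; definitions are explicit constructions) for
the perturbation of the intermittent convex-integration scheme of Buckmaster–Vicol (EMS Surv. Math.
Sci. 6 (2019), §7.5 (7.31)–(7.39)), in the variant needed for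
`Literature.Barriers.AnomalousDissipation.BuckmasterVicol2019_iterationFromLevel` (no energy
profile; building blocks the intermittent jets of `IntermittentJets`; amplitudes the algebraic
`JAmp.jamp`). The data are bundled in `JetStep.Datum` (horizon `T`, floor `γ₀`, the stress `M` to
be cancelled, jet parameters `μ, κ, σ, μ'` and the axial bump `g`); for `D : Datum`:

* `D.J x` — the jet parameters of direction `x`, with temporal frequency `ω_x = |k_x|² σ μ'` (so
  that `(k_x·∇)η_x = (μ')⁻¹ ∂ₜη_x` uniformly in `x`, BV (7.20)); `D.s` — the pre-shifts making the
  jets of distinct directions disjoint (BV (7.18));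
* `D.a x = a_x = jamp γ₀ M x` (BV (7.25)), `D.F x = a_x² η_x² ψ̃_x²`;
* `D.wp = ∑_x a_x W_x` (BV (7.33)), `D.wpc = ∑_x div(a_x Om_x) = w^{(p)} + w^{(c)}` (BV (7.35)–(7.36):
  "`w^{(p)} + w^{(c)} = curl(∑ a V)`", here through the skew potential `Om_x`), divergence free and of
  zero mean;
* the temporal corrector split into its non-gradient part `D.X = -(μ')⁻¹ ∑_x P_{≠0}(a_x² η²ψ̃² k_x)` and
  the gradient `∇(D.zeta)`, `D.zeta = (μ')⁻¹ Δ⁻¹ ∑_x (k_x·∇)(a_x² η²ψ̃²)`, so that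
  `w^{(t)} = X + ∇ζ = -(μ')⁻¹ ∑ P_H P_{≠0}(a² η²ψ̃² k)` is divergence free (BV (7.37));
* `D.w' = wpc + X`, `D.w = w' + ∇ζ`: jointly smooth on `[0, T] × 𝕋³`, divergence free, zero mean.

## References

* T. Buckmaster, V. Vicol, EMS Surv. Math. Sci. 6 (2019) = arXiv:1901.09023, §7.4 (7.18)–(7.21),
  §7.5 (7.25), (7.31)–(7.39). [`BuckmasterVicol2020`]
-/

noncomputable section

open MeasureTheory Set Filter Topology Function
open scoped InnerProductSpace ContDiff ENNReal

namespace Literature.Analysis.FluidPDE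

namespace JetStep

open Literature.Analysis.FunctionSpaces FunctionSpaces.Torus Mikado NashGeometric Jet

/-- Notation: the three-torus and its tangent space. -/
local notation "𝕋³" => UnitAddTorus (Fin 3)
local notation "E³" => EuclideanSpace ℝ (Fin 3)
local notation "Idx" => Index (Fin 3)

/-! ## The data of one step -/

/-- **The data of the perturbation** (BV §7.5): horizon `T`, amplitude floor `γ₀`, the symmetric
stress `M` to be cancelled, the jet parameters `μ` (transverse concentration), `κ` (axial
concentration), `σ` (cell frequency), `μ'` (the ratio `ω_x/(σ|k_x|²)`, written `mup`), and the
axial bump `g`. [cite: BuckmasterVicol2020, §7.5.1] -/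
structure Datum where
  /-- time horizon -/
  T : ℝ
  /-- floor of the amplitudes -/
  γ₀ : ℝ
  /-- the stress to be cancelled (by columns) -/
  M : ℝ → 𝕋³ → Fin 3 → E³
  /-- transverse concentration -/
  μ : ℝ
  /-- axial concentration -/
  κ : ℝ
  /-- cell frequency -/
  σ : ℕ
  /-- `μ' = ω_x / (σ |k_x|²)` -/
  mup : ℝ
  /-- the axial bump -/
  g : ℝ → ℝ

namespace Datum

variable (D : Datum)

/-- **Standing hypotheses**. [cite: BuckmasterVicol2020, §7.5.1] -/
structure Valid : Prop where
  hT : 0 < D.T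
  hγ : 0 < D.γ₀
  hM : Torus.IsSmoothSpaceTimeOn (Icc 0 D.T) D.M
  hMsym : ∀ t ∈ Icc 0 D.T, ∀ y, ∀ i j : Fin 3, D.M t y i j = D.M t y j i
  hμ : pipeConc ≤ D.μ
  hκ : 1 ≤ D.κ
  hσ : 0 < D.σ
  hmup : 0 < D.mup
  hg : Intermittent.IsBump D.g
  hg1 : ∫ s in (0 : ℝ)..1, D.g s ^ 2 = 1

/-- **The jet parameters of direction `x`**: `ω_x = |k_x|² σ μ'`. [cite: BuckmasterVicol2020, §7.4 (7.20)] -/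
def J (x : Idx) : Jet.Params := ⟨D.μ, D.κ, dirNormSq x * D.σ * D.mup, D.σ, D.g⟩

/-- The pre-shifts (depend on `σ` only). [cite: BuckmasterVicol2020, §7.4 (7.18)] -/
def s : Idx → 𝕋³ := fun x => Jet.preShift (D.J x) x

/-- **The amplitudes** `a_x = jamp γ₀ M x`. [cite: BuckmasterVicol2020, §7.5.1 (7.25)] -/
def a (x : Idx) (t : ℝ) (y : 𝕋³) : ℝ := JAmp.jamp D.γ₀ D.M x t y

/-- **The principal part** `w^{(p)} = ∑_x a_x W_x`. [cite: BuckmasterVicol2020, §7.5.2 (7.33)] -/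
def wp (t : ℝ) (y : 𝕋³) : E³ := ∑ x, D.a x t y • Jet.W (D.J x) D.s x t y

/-- **`w^{(p)} + w^{(c)} = ∑_x div (a_x Om_x)`**. [cite: BuckmasterVicol2020, §7.5.3 (7.35)–(7.36)] -/
def wpc (t : ℝ) (y : 𝕋³) : E³ := ∑ x, Torus.tensorDivergence (fun z j => D.a x t z • Jet.Om (D.J x) D.s x t z j) y

/-- The scalar `F_x = a_x² η_x² ψ̃_x²`. [cite: BuckmasterVicol2020, §7.5.3 (7.34)] -/
def F (x : Idx) (t : ℝ) (y : 𝕋³) : ℝ := D.a x t y ^ 2 * Jet.fastF (D.J x) D.s x t y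

/-- **The non-gradient part of the temporal corrector**
`X = -(μ')⁻¹ ∑_x (F_x - ∫F_x) k_x`. [cite: BuckmasterVicol2020, §7.5.3 (7.37)] -/
def X (t : ℝ) (y : 𝕋³) : E³ := -∑ x, (D.mup⁻¹ * (D.F x t y - ∫ z, D.F x t z)) • dirVec x

/-- The source of the gradient part: `G = (μ')⁻¹ ∑_x (k_x·∇)F_x`. [folklore] -/
def G (t : ℝ) (y : 𝕋³) : ℝ := ∑ x, D.mup⁻¹ * dirD x (D.F x t) y

/-- **The gradient potential of the temporal corrector** `ζ = Δ⁻¹ G`, so that `w^{(t)} = X + ∇ζ` is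
divergence free. [cite: BuckmasterVicol2020, §7.5.3 (7.37)] -/
def zeta (t : ℝ) : 𝕋³ → ℝ := Torus.invLaplacian (D.G t)

/-- The non-gradient part of the perturbation `w' = wpc + X`. [folklore] -/
def w' (t : ℝ) (y : 𝕋³) : E³ := D.wpc t y + D.X t y

/-- **The full perturbation** `w = w' + ∇ζ = w^{(p)} + w^{(c)} + w^{(t)}`. [cite: BuckmasterVicol2020, §7.5 (7.38)] -/
def w (t : ℝ) (y : 𝕋³) : E³ := D.w' t y + Torus.gradient (D.zeta t) y

/-! ## Validity of the jet parameters -/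

variable {D} (h : D.Valid)
include h

omit h in
/-- Smoothness / admissibility bookkeeping. [folklore] -/
theorem hd3 : 2 ≤ Fintype.card (Fin 3) := by simp

/-- Smoothness / admissibility bookkeeping. [folklore] -/
theorem one_le_μ : 1 ≤ D.μ := one_le_pipeConc.trans h.hμ

/-- Smoothness / admissibility bookkeeping. [folklore] -/
theorem uniqueDiffOn : UniqueDiffOn ℝ (Icc 0 D.T) := uniqueDiffOn_Icc h.hT

omit h in
/-- Smoothness / admissibility bookkeeping. [folklore] -/
theorem convex : Convex ℝ (Icc (0 : ℝ) D.T) := convex_Icc 0 D.T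

/-- Smoothness / admissibility bookkeeping. [folklore] -/
theorem interior_nonempty : (interior (Icc (0 : ℝ) D.T)).Nonempty := by rw [interior_Icc]; exact nonempty_Ioo.2 h.hT

/-- Each `J x` is admissible. [folklore] -/
theorem Jvalid (x : Idx) : (D.J x).Valid :=
  { hμ := one_le_μ h
    hκ := h.hκ
    hω := by
      show dirNormSq x * D.σ * D.mup ≠ 0
      have := dirNormSq_pos x
      have : (0 : ℝ) < D.σ := by exact_mod_cast h.hσ
      have := h.hmup
      positivity
    hσ := h.hσ
    hg := h.hg
    hg1 := h.hg1 }

omit h in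
/-- The temporal frequency. [folklore] -/
theorem J_om (x : Idx) : (D.J x).om = dirNormSq x * D.σ * D.mup := rfl

omit h in
/-- The shifts do not depend on the direction-dependent frequency: `D.s = preShift (D.J x₀)` for every `x₀`. [folklore] -/
theorem s_eq (x₀ : Idx) : D.s = Jet.preShift (D.J x₀) := by funext x; rfl

omit h in
/-- The transverse factors of all `J x₀` coincide. [folklore] -/
theorem psiJ_eq (x₀ x : Idx) : Jet.psiJ (D.J x₀) D.s x = Jet.psiJ (D.J x) D.s x := rfl

/-- **Disjointness** of jets of distinct directions: `ψ̃_x ψ̃_{x'} = 0` pointwise. [cite: BuckmasterVicol2020, §7.4 (7.18)] -/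
theorem psiJ_mul_psiJ {x x' : Idx} (hxx' : x ≠ x') (y : 𝕋³) : Jet.psiJ (D.J x) D.s x y * Jet.psiJ (D.J x') D.s x' y = 0 := by
  have h1 := Jet.psiJ_mul_psiJ_eq_zero (Jvalid h x) hxx' h.hμ y
  rw [← s_eq] at h1
  exact h1

/-! ## Smoothness -/

/-- Smoothness / admissibility bookkeeping. [folklore] -/
theorem smooth_a (x : Idx) : Torus.IsSmoothSpaceTimeOn (Icc 0 D.T) (D.a x) := JAmp.isSmoothSpaceTimeOn_jamp hd3 h.hγ h.hM x

/-- Smoothness / admissibility bookkeeping. [folklore] -/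
theorem isSmooth_a (x : Idx) {t : ℝ} (ht : t ∈ Icc 0 D.T) : Torus.IsSmooth (D.a x t) := (smooth_a h x).isSmooth_slice ht

/-- Smoothness / admissibility bookkeeping. [folklore] -/
theorem smooth_hsq (x : Idx) : Torus.IsSmoothSpaceTimeOn (Icc 0 D.T) (JAmp.hsq D.γ₀ D.M x) :=
  JAmp.isSmoothSpaceTimeOn_hsq hd3 h.hγ h.hM x

/-- Smoothness / admissibility bookkeeping. [folklore] -/
theorem a_sq (x : Idx) (t : ℝ) (y : 𝕋³) : D.a x t y ^ 2 = JAmp.hsq D.γ₀ D.M x t y := (JAmp.jamp_sq hd3 h.hγ x t y).1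

/-- Smoothness / admissibility bookkeeping. [folklore] -/
theorem smooth_eta (x : Idx) : Torus.IsSmoothSpaceTimeOn (Icc 0 D.T) (Jet.eta (D.J x) x) :=
  Jet.isSmoothSpaceTimeOn_eta (Jvalid h x) x _

/-- Smoothness / admissibility bookkeeping. [folklore] -/
theorem smooth_etaD (x : Idx) : Torus.IsSmoothSpaceTimeOn (Icc 0 D.T) (Jet.etaD (D.J x) x) :=
  Jet.isSmoothSpaceTimeOn_etaD (Jvalid h x) x _

/-- Smoothness / admissibility bookkeeping. [folklore] -/
theorem isSmooth_psiJ (x : Idx) : Torus.IsSmooth (Jet.psiJ (D.J x) D.s x) := Jet.isSmooth_psiJ D.s (Jvalid h x) x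

/-- Smoothness / admissibility bookkeeping. [folklore] -/
theorem isSmooth_phiJ (x : Idx) : Torus.IsSmooth (Jet.phiJ (D.J x) D.s x) := Jet.isSmooth_phiJ D.s (Jvalid h x) x

/-- Smoothness / admissibility bookkeeping. [folklore] -/
theorem smooth_fastF (x : Idx) : Torus.IsSmoothSpaceTimeOn (Icc 0 D.T) (Jet.fastF (D.J x) D.s x) := by
  have h1 := smooth_eta h x
  have h2 : Torus.IsSmoothSpaceTimeOn (Icc 0 D.T) (fun (_ : ℝ) => Jet.psiJ (D.J x) D.s x) :=
    Torus.isSmoothSpaceTimeOn_const (isSmooth_psiJ h x) _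
  have e : Jet.fastF (D.J x) D.s x = fun t y => (Jet.eta (D.J x) x t y * Jet.eta (D.J x) x t y) *
      (Jet.psiJ (D.J x) D.s x y * Jet.psiJ (D.J x) D.s x y) := by
    funext t y; simp only [Jet.fastF, sq]
  rw [e]; exact (h1.mul h1).mul (h2.mul h2)

/-- Smoothness / admissibility bookkeeping. [folklore] -/
theorem smooth_F (x : Idx) : Torus.IsSmoothSpaceTimeOn (Icc 0 D.T) (D.F x) := by
  have e : D.F x = fun t y => JAmp.hsq D.γ₀ D.M x t y * Jet.fastF (D.J x) D.s x t y := by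
    funext t y; rw [F, a_sq h]
  rw [e]; exact (smooth_hsq h x).mul (smooth_fastF h x)

/-- Smoothness / admissibility bookkeeping. [folklore] -/
theorem isSmooth_F (x : Idx) {t : ℝ} (ht : t ∈ Icc 0 D.T) : Torus.IsSmooth (D.F x t) := (smooth_F h x).isSmooth_slice ht

/-- Smoothness / admissibility bookkeeping. [folklore] -/
theorem smooth_Om (x : Idx) : Torus.IsSmoothSpaceTimeOn (Icc 0 D.T) (Jet.Om (D.J x) D.s x) :=
  Torus.isSmoothSpaceTimeOn_pi.2 fun j =>
    (smooth_eta h x).smul (Torus.isSmoothSpaceTimeOn_const (Jet.isSmooth_frame_col D.s (Jvalid h x) x j) _)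

/-- Smoothness / admissibility bookkeeping. [folklore] -/
theorem smooth_aOm (x : Idx) : Torus.IsSmoothSpaceTimeOn (Icc 0 D.T) (fun t z j => D.a x t z • Jet.Om (D.J x) D.s x t z j) :=
  Torus.isSmoothSpaceTimeOn_pi.2 fun j => (smooth_a h x).smul (Torus.isSmoothSpaceTimeOn_pi.1 (smooth_Om h x) j)

/-- Smoothness / admissibility bookkeeping. [folklore] -/
theorem smooth_wpc : Torus.IsSmoothSpaceTimeOn (Icc 0 D.T) D.wpc :=
  Torus.IsSmoothSpaceTimeOn.sum fun x _ => CL22.Datum.isSmoothSpaceTimeOn_tensorDivergence (smooth_aOm h x) (uniqueDiffOn h)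

/-- Smoothness / admissibility bookkeeping. [folklore] -/
theorem smooth_W (x : Idx) : Torus.IsSmoothSpaceTimeOn (Icc 0 D.T) (Jet.W (D.J x) D.s x) := by
  have h1 := (smooth_eta h x).mul (Torus.isSmoothSpaceTimeOn_const (isSmooth_psiJ h x) (Icc 0 D.T))
  exact h1.smul (Torus.isSmoothSpaceTimeOn_const (Torus.isSmooth_const (dirVec x)) _)

/-- Smoothness / admissibility bookkeeping. [folklore] -/
theorem smooth_wp : Torus.IsSmoothSpaceTimeOn (Icc 0 D.T) D.wp :=
  Torus.IsSmoothSpaceTimeOn.sum fun x _ => (smooth_a h x).smul (smooth_W h x)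

/-- Smoothness / admissibility bookkeeping. [folklore] -/
theorem smooth_X : Torus.IsSmoothSpaceTimeOn (Icc 0 D.T) D.X := by
  have hx : ∀ x, Torus.IsSmoothSpaceTimeOn (Icc 0 D.T) (fun t y => (D.mup⁻¹ * (D.F x t y - ∫ z, D.F x t z)) • dirVec x) := by
    intro x
    have h1 : Torus.IsSmoothSpaceTimeOn (Icc 0 D.T) (fun t y => D.mup⁻¹ * (D.F x t y - ∫ z, D.F x t z)) :=
      (Torus.isSmoothSpaceTimeOn_const (Torus.isSmooth_const _) _).mul
        ((smooth_F h x).sub ((smooth_F h x).integral_const (uniqueDiffOn h) (convex (D := D))))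
    exact h1.smul (Torus.isSmoothSpaceTimeOn_const (Torus.isSmooth_const (dirVec x)) _)
  have := Torus.IsSmoothSpaceTimeOn.sum (s := Finset.univ) fun x _ => hx x
  exact this.neg

/-- Smoothness / admissibility bookkeeping. [folklore] -/
theorem smooth_G : Torus.IsSmoothSpaceTimeOn (Icc 0 D.T) D.G := by
  refine Torus.IsSmoothSpaceTimeOn.sum fun x _ => ?_
  have hD : Torus.IsSmoothSpaceTimeOn (Icc 0 D.T) (fun t y => dirD x (D.F x t) y) :=
    Torus.IsSmoothSpaceTimeOn.sum fun j _ =>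
      (Torus.isSmoothSpaceTimeOn_const (Torus.isSmooth_const _) _).mul ((smooth_F h x).partialDeriv (uniqueDiffOn h) j)
  exact (Torus.isSmoothSpaceTimeOn_const (Torus.isSmooth_const _) _).mul hD

/-- Smoothness / admissibility bookkeeping. [folklore] -/
theorem smooth_zeta : Torus.IsSmoothSpaceTimeOn (Icc 0 D.T) D.zeta := (smooth_G h).invLaplacian (convex (D := D)) (interior_nonempty h)

/-- Smoothness / admissibility bookkeeping. [folklore] -/
theorem smooth_w' : Torus.IsSmoothSpaceTimeOn (Icc 0 D.T) D.w' := (smooth_wpc h).add (smooth_X h)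

/-- Smoothness / admissibility bookkeeping. [folklore] -/
theorem smooth_w : Torus.IsSmoothSpaceTimeOn (Icc 0 D.T) D.w := (smooth_w' h).add ((smooth_zeta h).gradient (uniqueDiffOn h))

/-! ## Divergence and mean -/

omit h in
/-- The divergence of `c • k` for a constant vector: `div(F k_x) = (k_x·∇)F`. [folklore] -/
theorem divergence_smul_dirVec {f : 𝕋³ → ℝ} (hf : Torus.IsSmooth f) (x : Idx) (y : 𝕋³) :
    Torus.divergence (fun z => f z • dirVec x) y = dirD x f y := by
  have h1 : Torus.IsContDiff 1 f := hf.isContDiff (by simp)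
  simp only [Torus.divergence, dirD]
  refine Finset.sum_congr rfl fun j _ => ?_
  have e : (fun z => (f z • dirVec x) j) = fun z => f z * (dir x j : ℝ) := by funext z; simp [dirVec]
  rw [e, Torus.partialDeriv_mul h1 (Torus.isContDiff_const _), Torus.partialDeriv_const_apply]
  ring

omit h in
/-- `∫ (k_x·∇)F = 0`. [folklore] -/
theorem integral_dirD {f : 𝕋³ → ℝ} (hf : Torus.IsSmooth f) (x : Idx) : ∫ y, dirD x f y = 0 := by
  simp only [dirD]
  rw [integral_finsetSum _ fun j _ => ((hf.partialDeriv j).integrable.const_mul _)]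
  exact Finset.sum_eq_zero fun j _ => by rw [integral_const_mul, Torus.integral_partialDeriv_eq_zero_holds hf j, mul_zero]

/-- `(k_x·∇)F_x` is jointly smooth. [folklore] -/
theorem smooth_dirD_F (x : Idx) : Torus.IsSmoothSpaceTimeOn (Icc 0 D.T) (fun t y => dirD x (D.F x t) y) :=
  Torus.IsSmoothSpaceTimeOn.sum fun j _ =>
    (Torus.isSmoothSpaceTimeOn_const (Torus.isSmooth_const _) _).mul ((smooth_F h x).partialDeriv (uniqueDiffOn h) j)

/-- `∫ G = 0`. [folklore] -/
theorem integral_G {t : ℝ} (ht : t ∈ Icc 0 D.T) : ∫ y, D.G t y = 0 := by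
  simp only [G]
  rw [integral_finsetSum _ fun x _ => ((smooth_dirD_F h x).isSmooth_slice ht).integrable.const_mul _]
  exact Finset.sum_eq_zero fun x _ => by rw [integral_const_mul, integral_dirD (isSmooth_F h x ht), mul_zero]

omit h in
/-- Divergence of a finite sum of smooth fields. [folklore] -/
theorem divergence_finset_sum {ι : Type*} {S : Finset ι} {u : ι → 𝕋³ → E³} (hu : ∀ i ∈ S, Torus.IsSmooth (u i)) (y : 𝕋³) :
    Torus.divergence (fun z => ∑ i ∈ S, u i z) y = ∑ i ∈ S, Torus.divergence (u i) y := by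
  classical
  induction S using Finset.induction_on with
  | empty => simp [Torus.divergence, Torus.partialDeriv, Torus.lineDeriv]
  | insert a S ha ih =>
    have hu' : ∀ i ∈ S, Torus.IsSmooth (u i) := fun i hi => hu i (Finset.mem_insert_of_mem hi)
    have hsum : Torus.IsSmooth (fun z => ∑ i ∈ S, u i z) := Torus.isSmooth_finset_sum S hu'
    simp only [Finset.sum_insert ha]
    rw [← ih hu']
    exact Torus.divergence_add' (hu a (Finset.mem_insert_self a S)) hsum y

omit h in
/-- `(k_x·∇)(c (f - m)) = c (k_x·∇)f` for constants `c, m`. [folklore] -/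
theorem dirD_affine {f : 𝕋³ → ℝ} (hf : Torus.IsSmooth f) (c m : ℝ) (x : Idx) (y : 𝕋³) :
    dirD x (fun z => c * (f z - m)) y = c * dirD x f y := by
  have h1 : Torus.IsContDiff 1 f := hf.isContDiff (by simp)
  have e : (fun z => c * (f z - m)) = fun z => (fun _ => c) z * f z + (fun _ => -(c * m)) z := by funext z; ring
  simp only [dirD, Finset.mul_sum]
  refine Finset.sum_congr rfl fun j _ => ?_
  have hcf : Torus.IsSmooth (fun z => (fun _ => c) z * f z) := (Torus.isSmooth_const c).mul hf
  rw [e, show (fun z => (fun _ => c) z * f z + (fun _ => -(c * m)) z) = (fun z => (fun _ => c) z * f z) + fun _ => -(c * m) from rfl,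
    Torus.partialDeriv_add (hcf.isContDiff (by simp)) (Torus.isContDiff_const _),
    Pi.add_apply, Torus.partialDeriv_const_apply, add_zero, Torus.partialDeriv_mul (Torus.isContDiff_const _) h1,
    Torus.partialDeriv_const_apply]
  ring

/-- **`div wpc = 0`** (`div div` of skew tensors). [cite: BuckmasterVicol2020, §7.5.3 (7.36)] -/
theorem divergence_wpc {t : ℝ} (ht : t ∈ Icc 0 D.T) (y : 𝕋³) : Torus.divergence (D.wpc t) y = 0 := by
  have hsm : ∀ x, Torus.IsSmooth (fun z j => D.a x t z • Jet.Om (D.J x) D.s x t z j) := fun x => (smooth_aOm h x).isSmooth_slice ht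
  have e : D.wpc t = fun y => ∑ x, Torus.tensorDivergence (fun z j => D.a x t z • Jet.Om (D.J x) D.s x t z j) y := rfl
  rw [e, divergence_finset_sum (fun x _ => (hsm x).tensorDivergence)]
  refine Finset.sum_eq_zero fun x _ => ?_
  exact CL22.Datum.divergence_tensorDivergence_of_skew (hsm x)
    (fun z i j => by simp only [PiLp.smul_apply, smul_eq_mul, Jet.Om_skew D.s (Jvalid h x) x t z i j, mul_neg]) y

/-- `∫ wpc = 0`. [folklore] -/
theorem integral_wpc {t : ℝ} (ht : t ∈ Icc 0 D.T) : ∫ y, D.wpc t y = 0 := by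
  have hsm : ∀ x, Torus.IsSmooth (fun z j => D.a x t z • Jet.Om (D.J x) D.s x t z j) := fun x => (smooth_aOm h x).isSmooth_slice ht
  have e : D.wpc t = fun y => ∑ x, Torus.tensorDivergence (fun z j => D.a x t z • Jet.Om (D.J x) D.s x t z j) y := rfl
  rw [e, integral_finsetSum _ fun x _ => (hsm x).tensorDivergence.integrable]
  exact Finset.sum_eq_zero fun x _ => Torus.integral_tensorDivergence_eq_zero' (hsm x)

/-- The summands of `X` are smooth. [folklore] -/
theorem isSmooth_Xterm {t : ℝ} (ht : t ∈ Icc 0 D.T) (x : Idx) :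
    Torus.IsSmooth (fun z => (D.mup⁻¹ * (D.F x t z - ∫ z', D.F x t z')) • dirVec x) := by
  have h1 : Torus.IsSmooth (fun z => D.mup⁻¹ * (D.F x t z - ∫ z', D.F x t z')) :=
    (Torus.isSmooth_const _).mul ((isSmooth_F h x ht).sub (Torus.isSmooth_const _))
  exact h1.smul' (Torus.isSmooth_const _)

omit h in
/-- `X = (-1) • ∑ (summands)`. [folklore] -/
theorem X_eq (t : ℝ) : D.X t = (-1 : ℝ) • fun z => ∑ x, (D.mup⁻¹ * (D.F x t z - ∫ z', D.F x t z')) • dirVec x := by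
  funext z
  show -(∑ x, (D.mup⁻¹ * (D.F x t z - ∫ z', D.F x t z')) • dirVec x) = _
  rw [Pi.smul_apply, neg_one_smul]

/-- `div X = -G`. [folklore] -/
theorem divergence_X {t : ℝ} (ht : t ∈ Icc 0 D.T) (y : 𝕋³) : Torus.divergence (D.X t) y = -D.G t y := by
  have hterm := isSmooth_Xterm h ht
  have hsum : Torus.IsSmooth (fun z => ∑ x, (D.mup⁻¹ * (D.F x t z - ∫ z', D.F x t z')) • dirVec x) :=
    Torus.isSmooth_finset_sum _ fun x _ => hterm x
  rw [X_eq, Torus.divergence_const_smul (hsum.isContDiff (by simp)), divergence_finset_sum (fun x _ => hterm x) y]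
  simp only [G, neg_one_mul, ← Finset.sum_neg_distrib]
  refine Finset.sum_congr rfl fun x _ => ?_
  rw [neg_inj]
  have hFx : Torus.IsSmooth (fun z => D.mup⁻¹ * (D.F x t z - ∫ z', D.F x t z')) :=
    (Torus.isSmooth_const _).mul ((isSmooth_F h x ht).sub (Torus.isSmooth_const _))
  rw [divergence_smul_dirVec hFx x y, dirD_affine (isSmooth_F h x ht)]

/-- `Δζ = G` (`∫G = 0`). [folklore] -/
theorem laplacian_zeta {t : ℝ} (ht : t ∈ Icc 0 D.T) (y : 𝕋³) : Torus.laplacian (D.zeta t) y = D.G t y := by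
  rw [zeta, Torus.laplacian_invLaplacian ((smooth_G h).isSmooth_slice ht), integral_G h ht, sub_zero]

/-- **`div w = 0`**. [cite: BuckmasterVicol2020, §7.5 (7.38)] -/
theorem isDivFree_w {t : ℝ} (ht : t ∈ Icc 0 D.T) : Torus.IsDivFree (D.w t) := by
  intro y
  have hw' : Torus.IsSmooth (D.w' t) := (smooth_w' h).isSmooth_slice ht
  have hζ : Torus.IsSmooth (D.zeta t) := (smooth_zeta h).isSmooth_slice ht
  have hwpc : Torus.IsSmooth (D.wpc t) := (smooth_wpc h).isSmooth_slice ht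
  have hX : Torus.IsSmooth (D.X t) := (smooth_X h).isSmooth_slice ht
  show Torus.divergence (fun y => D.w' t y + Torus.gradient (D.zeta t) y) y = 0
  rw [Torus.divergence_add' hw' hζ.gradient, Torus.divergence_gradient' hζ, laplacian_zeta h ht,
    show D.w' t = fun y => D.wpc t y + D.X t y from rfl, Torus.divergence_add' hwpc hX, divergence_wpc h ht, divergence_X h ht]
  ring

/-- **`∫ w = 0`**. [folklore] -/
theorem hasZeroMean_w {t : ℝ} (ht : t ∈ Icc 0 D.T) : Torus.HasZeroMean (D.w t) := by
  have hζ : Torus.IsSmooth (D.zeta t) := (smooth_zeta h).isSmooth_slice ht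
  have hwpc : Torus.IsSmooth (D.wpc t) := (smooth_wpc h).isSmooth_slice ht
  have hX : Torus.IsSmooth (D.X t) := (smooth_X h).isSmooth_slice ht
  show ∫ y, (D.w' t y + Torus.gradient (D.zeta t) y) = 0
  rw [integral_add (((smooth_w' h).isSmooth_slice ht).integrable) hζ.gradient.integrable, Torus.integral_gradient_eq_zero hζ, add_zero,
    show D.w' t = fun y => D.wpc t y + D.X t y from rfl, integral_add hwpc.integrable hX.integrable, integral_wpc h ht, zero_add]
  -- `∫ X = 0`: each summand is `(F - ∫F) k`
  have hterm : ∀ x, Integrable (fun z => (D.mup⁻¹ * (D.F x t z - ∫ z', D.F x t z')) • dirVec x) volume := fun x =>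
    (isSmooth_Xterm h ht x).integrable
  rw [X_eq]
  show ∫ y, (-1 : ℝ) • (∑ x, (D.mup⁻¹ * (D.F x t y - ∫ z', D.F x t z')) • dirVec x) = 0
  rw [integral_smul, integral_finsetSum _ fun x _ => hterm x, Finset.sum_eq_zero fun x _ => ?_, smul_zero]
  rw [integral_smul_const, integral_const_mul, integral_sub (isSmooth_F h x ht).integrable (integrable_const _),
    MeasureTheory.integral_const, smul_eq_mul, probReal_univ, one_mul, sub_self, mul_zero, zero_smul]

end Datum

end JetStep

end Literature.Analysis.FluidPDE
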